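import Summits.AnomalousDissipation.AnomalousDissipation.Theorems.TaylorCertificatePair.Negative.Ceiling
import Literature.Analysis.FunctionSpaces.TorusFourierSynthesis
import Literature.Analysis.FunctionSpaces.TorusFourierSeries

/-!
# `TaylorCertificates.FloorCertificate` (stmt-AnomalousDissipation-14091) — negative side, tools for the
# frozen-multiplier beat (`Negative/Uniform.lean`)

Support lemmas (cdisprove seat `refuter-cdisprove-stmt-AnomalousDissipation-14091-0`, 2026-08-16) for the
refutation `not_floorCertificateUniform` of the ν-independent strengthening of the crux, written over the
tree's objects (no new definitions):

* Fourier side of a cylindrical differential: `fc_grad_eq_sum` (`𝓕(Φ'(u))(κ) = ∑ᵢ cᵢ(u) ĝᵢ(κ)`),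
  `integral_inner_grad_right`, `coords_zero`, `exists_fc_grad_zero_ne_zero` (a multiplier pushing at
  rest has a nonzero mode), `norm_fc_grad_le`.
* `inertial_two` — the PAIR FORMULA for two transversal waves at `p`, `p + q` against a smooth `G`:
  only the self-sum mode `2p + q` and the BEAT at `q` survive.
* Escaping rays `t ↦ t s + c` on the lattice: `injective_ray`, `tendsto_ray_cofinite`, and
  RIEMANN–LEBESGUE along them for smooth fields, `tendsto_fc_ray`, `tendsto_re_inner_fc_ray`
  (from the tree's `summable_norm_mFourierCoeff_of_isSmooth`).
* Small algebra of the ray `(t+1) r` (`ray_*`), the norm bound `norm_pi_mul_im_le`, and the choice of a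
  small viscosity `exists_small_viscosity`.
-/

noncomputable section

set_option linter.dupNamespace false

open MeasureTheory UnitAddTorus Matrix Filter Topology
open scoped InnerProductSpace ENNReal ComplexConjugate

namespace Summit.AnomalousDissipation.AnomalousDissipation.Theorems.FloorCertificate.Negative

open Literature.Analysis.FunctionSpaces Literature.Analysis.FluidPDE
open Summit.AnomalousDissipation.AnomalousDissipation.Theses.TaylorCertificates
open Summit.AnomalousDissipation.AnomalousDissipation.Theorems.TaylorCertificatePair.Negative

/-! ### §E.1 The differential of a cylindrical functional in Fourier variables -/

section GradFourier

variable (Φ : Torus.CylindricalTest (Fin 3))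

/-- Fourier coefficients of `Φ'(u) = ∑ᵢ cᵢ(u) gᵢ`: `𝓕(Φ'(u))(κ) = ∑ᵢ cᵢ(u) ĝᵢ(κ)`. -/
theorem fc_grad_eq_sum (u : (Torus.energySpace (Fin 3))) (κ : Fin 3 → ℤ) :
    mFourierCoeff (EuclideanSpace.complexify ∘ Φ.grad u) κ =
      ∑ i, ((_root_.fderiv ℝ Φ.φ (Φ.coords u) (EuclideanSpace.single i 1) : ℝ) : ℂ) •
        mFourierCoeff (EuclideanSpace.complexify ∘ Φ.g i) κ := by
  rw [Torus.CylindricalTest.grad_eq_sum_smul]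
  set c : Fin Φ.m → ℝ := fun i => _root_.fderiv ℝ Φ.φ (Φ.coords u) (EuclideanSpace.single i 1)
  have h : (EuclideanSpace.complexify ∘ fun x => ∑ i ∈ Finset.univ, c i • Φ.g i x) =
      fun x => ∑ i ∈ Finset.univ, ((c i : ℂ) • (EuclideanSpace.complexify ∘ Φ.g i)) x := by
    funext x
    simp only [Function.comp_apply, map_sum, Pi.smul_apply, LinearIsometry.map_smul,
      Complex.coe_smul]
  rw [h, Torus.mFourierCoeff_finset_sum _ (fun i _ =>
    (Torus.integrable_complexify_comp (Φ.g_smooth i).integrable).smul _)]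
  refine Finset.sum_congr rfl fun i _ => ?_
  rw [Torus.mFourierCoeff_const_smul]

/-- Pairing a field with `Φ'(u)`: `(w, Φ'(u)) = ∑ᵢ cᵢ(u) (w, gᵢ)`. -/
theorem integral_inner_grad_right {w : (UnitAddTorus (Fin 3) → EuclideanSpace ℝ (Fin 3))} (hw : Integrable w volume) (u : (Torus.energySpace (Fin 3))) :
    ∫ x, ⟪w x, Φ.grad u x⟫_ℝ =
      ∑ i, _root_.fderiv ℝ Φ.φ (Φ.coords u) (EuclideanSpace.single i 1) * ∫ x, ⟪w x, Φ.g i x⟫_ℝ := by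
  rw [Torus.CylindricalTest.grad_eq_sum_smul]
  simp_rw [inner_sum, real_inner_smul_right]
  rw [integral_finsetSum _ (fun i _ => (Torus.integrable_inner_of_continuous hw (Φ.g_smooth i).continuous).const_mul _)]
  exact Finset.sum_congr rfl fun i _ => integral_const_mul _ _

/-- The cylindrical coordinates of the rest state vanish. -/
theorem coords_zero : Φ.coords (0 : (Torus.energySpace (Fin 3))) = 0 := by
  ext i
  rw [coords_of_ae coe_zero_ae]
  simp

/-- If the multiplier pushes at rest, `(f, Φ'(0)) > 0`, then `Φ'(0)` has a nonzero Fourier mode `q ≠ 0`. -/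
theorem exists_fc_grad_zero_ne_zero {f : (UnitAddTorus (Fin 3) → EuclideanSpace ℝ (Fin 3))} (hpos : 0 < ∫ x, ⟪f x, Φ.grad 0 x⟫_ℝ) :
    ∃ q : Fin 3 → ℤ, q ≠ 0 ∧ mFourierCoeff (EuclideanSpace.complexify ∘ Φ.grad 0) q ≠ 0 := by
  by_contra h
  push Not at h
  have hall : ∀ κ, mFourierCoeff (EuclideanSpace.complexify ∘ Φ.grad (0 : (Torus.energySpace (Fin 3)))) κ = 0 := by
    intro κ
    by_cases hκ : κ = 0
    · rw [hκ]; exact fc_grad_zero Φ 0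
    · exact h κ hκ
  have hzero : (EuclideanSpace.complexify ∘ Φ.grad (0 : (Torus.energySpace (Fin 3)))) = 0 :=
    Torus.eq_zero_of_forall_mFourierCoeff_eq_zero (isSmooth_grad Φ 0).complexify_comp.continuous hall
  have hgrad : ∀ x, Φ.grad (0 : (Torus.energySpace (Fin 3))) x = 0 := by
    intro x
    have hx := congrFun hzero x
    simp only [Function.comp_apply, Pi.zero_apply] at hx
    have hn : ‖Φ.grad (0 : (Torus.energySpace (Fin 3))) x‖ = 0 := by rw [← EuclideanSpace.norm_complexify, hx, norm_zero]
    exact norm_eq_zero.1 hn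
  have : (∫ x, ⟪f x, Φ.grad 0 x⟫_ℝ) = 0 := by
    simp [hgrad]
  linarith

end GradFourier

/-! ### §E.2 The two-wave state: exact inertial term -/

/-- **Two beating waves.** The inertial term of `Re(e_p zA) + Re(e_{p+q} zB)` against a smooth `G`, when
`zA ⊥ p`, `zB ⊥ p + q`, `zB ⊥ p`, `zB ⊥ q`: only the self-sum mode `2p + q` and the BEAT at `q` survive,
`I = π Im[(q·zA) ⟨Ĝ(2p+q), zB⟩] + π Im[conj(q·zA) ⟨Ĝ(q), zB⟩]`. -/
theorem inertial_two {G : (UnitAddTorus (Fin 3) → EuclideanSpace ℝ (Fin 3))} (hG : Torus.IsSmooth G) (p q : Fin 3 → ℤ) (zA zB : EuclideanSpace ℂ (Fin 3))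
    (hA : ((fun j => ((p) j : ℂ)) ⬝ᵥ (WithLp.ofLp (zA))) = 0)
    (hB : ((fun j => (((p + q)) j : ℂ)) ⬝ᵥ (WithLp.ofLp (zB))) = 0)
    (hpB : ((fun j => ((p) j : ℂ)) ⬝ᵥ (WithLp.ofLp (zB))) = 0)
    (hqB : ((fun j => ((q) j : ℂ)) ⬝ᵥ (WithLp.ofLp (zB))) = 0) :
    ∫ x, ⟪Torus.fderiv G x ((∑ mm, Torus.realTrigPoly {![p, p + q] mm} (fun _ => ![zA, zB] mm)) x),
        (∑ mm, Torus.realTrigPoly {![p, p + q] mm} (fun _ => ![zA, zB] mm)) x⟫_ℝ =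
      Real.pi * ((((fun j => ((q) j : ℂ)) ⬝ᵥ (WithLp.ofLp (zA)))) *
          ⟪(mFourierCoeff (EuclideanSpace.complexify ∘ G) (p + (p + q))), zB⟫_ℂ).im +
        Real.pi * (conj (((fun j => ((q) j : ℂ)) ⬝ᵥ (WithLp.ofLp (zA)))) *
          ⟪(mFourierCoeff (EuclideanSpace.complexify ∘ G) q), zB⟫_ℂ).im := by
  rw [inertial_modes hG]
  have e1 : p + q - p = q := add_sub_cancel_left p q
  have e2' : p - (p + q) = -q := by abel
  have d11 : ((fun j => (((p + p)) j : ℂ)) ⬝ᵥ (WithLp.ofLp (zA))) = 0 := by rw [dotc_add_left, hA, add_zero]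
  have d22 : ((fun j => (((p + q + (p + q))) j : ℂ)) ⬝ᵥ (WithLp.ofLp (zB))) = 0 := by rw [dotc_add_left, hB, add_zero]
  have d12 : ((fun j => (((p + (p + q))) j : ℂ)) ⬝ᵥ (WithLp.ofLp (zA))) = ((fun j => ((q) j : ℂ)) ⬝ᵥ (WithLp.ofLp (zA))) := by
    rw [dotc_add_left, hA, zero_add, dotc_add_left, hA, zero_add]
  have d21 : ((fun j => (((p + q + p)) j : ℂ)) ⬝ᵥ (WithLp.ofLp (zB))) = 0 := by rw [dotc_add_left, hB, hpB, add_zero]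
  have dnq : ((fun j => (((-q)) j : ℂ)) ⬝ᵥ (WithLp.ofLp (zB))) = 0 := by rw [dotc_neg_left, hqB, neg_zero]
  have hA2 : ((fun j => (((p + q - p)) j : ℂ)) ⬝ᵥ (WithLp.ofLp (zA))) = ((fun j => ((q) j : ℂ)) ⬝ᵥ (WithLp.ofLp (zA))) := by rw [e1]
  simp only [Fin.sum_univ_two, Matrix.cons_val_zero, Matrix.cons_val_one,
    sub_self, dotc_zero_left, d11, d22, d12, d21, hA2, e2', dnq,
    zero_mul, mul_zero, map_zero, Complex.zero_im, add_zero, zero_add]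
  rw [e1]

/-! ### §E.3 Escaping frequencies and Riemann–Lebesgue -/

/-- The lattice ray `t ↦ t s + c` (`s ≠ 0`) is injective. -/
theorem injective_ray {s : Fin 3 → ℤ} (hs : s ≠ 0) (c : Fin 3 → ℤ) :
    Function.Injective (fun t : ℕ => (fun i => (t : ℤ) * s i) + c) := by
  intro t t' h
  have h' : (fun i => (t : ℤ) * s i) = fun i => (t' : ℤ) * s i := add_right_cancel h
  obtain ⟨i, hi⟩ : ∃ i, s i ≠ 0 := by
    by_contra hcon
    push Not at hcon
    exact hs (funext hcon)
  have := congrFun h' i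
  exact_mod_cast mul_right_cancel₀ hi this

/-- Escaping to infinity: the ray leaves every finite set of frequencies. -/
theorem tendsto_ray_cofinite {s : Fin 3 → ℤ} (hs : s ≠ 0) (c : Fin 3 → ℤ) :
    Tendsto (fun t : ℕ => (fun i => (t : ℤ) * s i) + c) atTop cofinite :=
  Nat.cofinite_eq_atTop ▸ (injective_ray hs c).tendsto_cofinite

/-- **Riemann–Lebesgue along a ray**: the Fourier coefficients of a smooth field vanish at infinity
(absolute summability of the coefficients of a smooth field, tree fact
`summable_norm_mFourierCoeff_of_isSmooth`). -/
theorem tendsto_fc_ray {g : (UnitAddTorus (Fin 3) → EuclideanSpace ℝ (Fin 3))} (hg : Torus.IsSmooth g) {s : Fin 3 → ℤ} (hs : s ≠ 0) (c : Fin 3 → ℤ) :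
    Tendsto (fun t : ℕ => ‖mFourierCoeff (EuclideanSpace.complexify ∘ g) ((fun i => (t : ℤ) * s i) + c)‖)
      atTop (𝓝 0) :=
  ((Torus.summable_norm_mFourierCoeff_of_isSmooth hg).tendsto_cofinite_zero).comp (tendsto_ray_cofinite hs c)

/-- Pairings `Re⟪z, ĝ(k_t)⟫` along an escaping ray tend to zero. -/
theorem tendsto_re_inner_fc_ray {g : (UnitAddTorus (Fin 3) → EuclideanSpace ℝ (Fin 3))} (hg : Torus.IsSmooth g) {s : Fin 3 → ℤ} (hs : s ≠ 0)
    (c : Fin 3 → ℤ) (z : EuclideanSpace ℂ (Fin 3)) :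
    Tendsto (fun t : ℕ => (⟪z, mFourierCoeff (EuclideanSpace.complexify ∘ g) ((fun i => (t : ℤ) * s i) + c)⟫_ℂ).re)
      atTop (𝓝 0) := by
  refine squeeze_zero_norm (fun t => ?_) (by simpa using (tendsto_fc_ray hg hs c).const_mul ‖z‖)
  rw [Real.norm_eq_abs]
  exact abs_re_inner_le_norm_mul _ _

/-! ### §E.4 Small algebra for the ray `P t = (t+1) r` and norm bounds -/

/-- Norm of a Fourier coefficient of `Φ'(u)`: `‖𝓕(Φ'(u))(κ)‖ ≤ ∑ᵢ |cᵢ(u)| ‖ĝᵢ(κ)‖`. -/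
theorem norm_fc_grad_le (Φ : Torus.CylindricalTest (Fin 3)) (u : (Torus.energySpace (Fin 3))) (κ : Fin 3 → ℤ) :
    ‖mFourierCoeff (EuclideanSpace.complexify ∘ Φ.grad u) κ‖ ≤
      ∑ i, |_root_.fderiv ℝ Φ.φ (Φ.coords u) (EuclideanSpace.single i 1)| *
        ‖mFourierCoeff (EuclideanSpace.complexify ∘ Φ.g i) κ‖ := by
  rw [fc_grad_eq_sum]
  refine (norm_sum_le _ _).trans (Finset.sum_le_sum fun i _ => ?_)
  rw [norm_smul, Complex.norm_real, Real.norm_eq_abs]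

/-- `|π Im(a ⟪v, z⟫)| ≤ π |a| |z| |v|`. -/
theorem norm_pi_mul_im_le (a : ℂ) (v z : EuclideanSpace ℂ (Fin 3)) :
    ‖Real.pi * (a * ⟪v, z⟫_ℂ).im‖ ≤ Real.pi * ‖a‖ * ‖z‖ * ‖v‖ := by
  rw [norm_mul, Real.norm_of_nonneg Real.pi_pos.le]
  have h1 : ‖(a * ⟪v, z⟫_ℂ).im‖ ≤ ‖a * ⟪v, z⟫_ℂ‖ := by
    rw [Real.norm_eq_abs]; exact Complex.abs_im_le_norm _
  have h2 : ‖a * ⟪v, z⟫_ℂ‖ ≤ ‖a‖ * (‖v‖ * ‖z‖) := by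
    rw [norm_mul]; exact mul_le_mul_of_nonneg_left (norm_inner_le_norm _ _) (norm_nonneg _)
  calc Real.pi * ‖(a * ⟪v, z⟫_ℂ).im‖ ≤ Real.pi * (‖a‖ * (‖v‖ * ‖z‖)) :=
        mul_le_mul_of_nonneg_left (h1.trans h2) Real.pi_pos.le
    _ = Real.pi * ‖a‖ * ‖z‖ * ‖v‖ := by ring

section Ray

variable {r q : Fin 3 → ℤ}

/-- `((t+1) r) · q = 0` when `r ⊥ q`. -/
theorem ray_dot (hrq : r ⬝ᵥ q = 0) (t : ℕ) : ((fun i => (t : ℤ) * r i) + r) ⬝ᵥ q = 0 := by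
  have h : ((fun i => (t : ℤ) * r i) + r) ⬝ᵥ q = ((t : ℤ) + 1) * (r ⬝ᵥ q) := by
    simp only [dotProduct, Pi.add_apply, Finset.mul_sum]
    exact Finset.sum_congr rfl fun i _ => by ring
  rw [h, hrq, mul_zero]

/-- `((t+1) r + q) · q = |q|²`. -/
theorem ray_add_dot (hrq : r ⬝ᵥ q = 0) (t : ℕ) : ((fun i => (t : ℤ) * r i) + r + q) ⬝ᵥ q = q ⬝ᵥ q := by
  rw [add_dotProduct, ray_dot hrq, zero_add]

/-- `(t+1) r ≠ 0` for `r ≠ 0`. -/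
theorem ray_ne_zero (hr : r ≠ 0) (t : ℕ) : ((fun i => (t : ℤ) * r i) + r) ≠ 0 := by
  intro h
  apply hr
  funext i
  have hi := congrFun h i
  simp only [Pi.add_apply, Pi.zero_apply] at hi
  have : ((t : ℤ) + 1) * r i = 0 := by linarith
  rcases mul_eq_zero.1 this with h1 | h1
  · omega
  · simpa using h1

/-- `r + r ≠ 0` for `r ≠ 0`. -/
theorem two_ray_ne_zero (hr : r ≠ 0) : r + r ≠ 0 := by
  intro h
  apply hr
  funext i
  have hi := congrFun h i
  simp only [Pi.add_apply, Pi.zero_apply] at hi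
  simp only [Pi.zero_apply]
  omega

/-- `(t+1) r + q ≠ 0` for `q ≠ 0`, `r ⊥ q`. -/
theorem ray_add_ne_zero (hq : q ≠ 0) (hrq : r ⬝ᵥ q = 0) (t : ℕ) : ((fun i => (t : ℤ) * r i) + r + q) ≠ 0 := by
  intro h
  have h1 := ray_add_dot hrq t
  rw [h, zero_dotProduct] at h1
  have h2 : Torus.freqNormSq q = ((q ⬝ᵥ q : ℤ) : ℝ) := by rw [freqNormSq_eq_castR_dot, castR_dot]
  have h3 := Torus.one_le_freqNormSq_of_ne_zero hq
  rw [h2, ← h1] at h3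
  norm_num at h3

/-- Real form of the transversality of the ray to a vector `B ⊥ r`: `∑ⱼ ((t+1) r)ⱼ Bⱼ = 0`. -/
theorem ray_sum_mul (B : EuclideanSpace ℝ (Fin 3)) (hrB : (∑ j, (r j : ℝ) * B j) = 0) (t : ℕ) :
    (∑ j, ((((fun i => (t : ℤ) * r i) + r) j : ℝ)) * B j) = 0 := by
  have h : (∑ j, ((((fun i => (t : ℤ) * r i) + r) j : ℝ)) * B j) = ((t : ℝ) + 1) * ∑ j, (r j : ℝ) * B j := by
    simp only [Pi.add_apply, Int.cast_add, Int.cast_mul, Int.cast_natCast, Finset.mul_sum]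
    exact Finset.sum_congr rfl fun j _ => by ring
  rw [h, hrB, mul_zero]

/-- Same with the beat frequency added: `∑ⱼ ((t+1) r + q)ⱼ Bⱼ = 0` when also `B ⊥ q`. -/
theorem ray_add_sum_mul (B : EuclideanSpace ℝ (Fin 3)) (hrB : (∑ j, (r j : ℝ) * B j) = 0)
    (hqB : (∑ j, (q j : ℝ) * B j) = 0) (t : ℕ) :
    (∑ j, ((((fun i => (t : ℤ) * r i) + r + q) j : ℝ)) * B j) = 0 := by
  have h : (∑ j, ((((fun i => (t : ℤ) * r i) + r + q) j : ℝ)) * B j) =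
      (∑ j, ((((fun i => (t : ℤ) * r i) + r) j : ℝ)) * B j) + ∑ j, (q j : ℝ) * B j := by
    rw [← Finset.sum_add_distrib]
    exact Finset.sum_congr rfl fun j _ => by simp only [Pi.add_apply, Int.cast_add]; ring
  rw [h, ray_sum_mul B hrB, hqB, add_zero]

/-- The self-sum frequency of the two waves lies on the ray of step `r + r`. -/
theorem ray_self_sum (t : ℕ) :
    ((fun i => (t : ℤ) * r i) + r) + (((fun i => (t : ℤ) * r i) + r) + q) =
      (fun i => (t : ℤ) * (r + r) i) + (r + r + q) := by
  funext i
  simp only [Pi.add_apply]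
  ring

/-- The second wave frequency on the unit-step ray shifted by `r + q`. -/
theorem ray_add_eq (t : ℕ) :
    ((fun i => (t : ℤ) * r i) + r) + q = (fun i => (t : ℤ) * r i) + (r + q) := add_assoc _ _ _

end Ray

/-- Choice of a small viscosity meeting finitely many smallness demands (pure arithmetic). -/
theorem exists_small_viscosity {ν₀ F2 A E L θ : ℝ} (hν₀ : 0 < ν₀) (hF2 : 0 < F2) (hE : 0 ≤ E) (hθ : θ ≤ 0) :
    ∃ ν : ℝ, 0 < ν ∧ ν < ν₀ ∧ ν ≤ 1 ∧ ν ≤ F2 / (A ^ 2 + 1) ∧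
      ν * ((1 - 2 * θ) * E) ≤ 1 / 4 ∧ ν * |L| ≤ 1 / 4 := by
  have hx : 0 ≤ (1 - 2 * θ) * E := mul_nonneg (by linarith) hE
  have h1 : 0 < F2 / (A ^ 2 + 1) := div_pos hF2 (by positivity)
  have h2 : 0 < 1 / (4 * ((1 - 2 * θ) * E + 1)) := by positivity
  have h3 : 0 < 1 / (4 * (|L| + 1)) := by positivity
  set m : ℝ := min (ν₀ / 2) (min 1 (min (F2 / (A ^ 2 + 1))
    (min (1 / (4 * ((1 - 2 * θ) * E + 1))) (1 / (4 * (|L| + 1)))))) with hm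
  have hm0 : 0 < m := by
    rw [hm]
    exact lt_min (half_pos hν₀) (lt_min one_pos (lt_min h1 (lt_min h2 h3)))
  refine ⟨m, hm0, ?_, ?_, ?_, ?_, ?_⟩
  · exact (min_le_left _ _).trans_lt (by linarith)
  · exact (min_le_right _ _).trans (min_le_left _ _)
  · exact (min_le_right _ _).trans ((min_le_right _ _).trans (min_le_left _ _))
  · have hle : m ≤ 1 / (4 * ((1 - 2 * θ) * E + 1)) :=
      (min_le_right _ _).trans ((min_le_right _ _).trans ((min_le_right _ _).trans (min_le_left _ _)))
    calc m * ((1 - 2 * θ) * E) ≤ 1 / (4 * ((1 - 2 * θ) * E + 1)) * ((1 - 2 * θ) * E) :=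
          mul_le_mul_of_nonneg_right hle hx
      _ ≤ 1 / 4 := by
        rw [div_mul_eq_mul_div, one_mul, div_le_div_iff₀ (by positivity) (by norm_num)]
        nlinarith
  · have hle : m ≤ 1 / (4 * (|L| + 1)) :=
      (min_le_right _ _).trans ((min_le_right _ _).trans ((min_le_right _ _).trans (min_le_right _ _)))
    have hx' : 0 ≤ |L| := abs_nonneg _
    calc m * |L| ≤ 1 / (4 * (|L| + 1)) * |L| := mul_le_mul_of_nonneg_right hle hx'
      _ ≤ 1 / 4 := by
        rw [div_mul_eq_mul_div, one_mul, div_le_div_iff₀ (by positivity) (by norm_num)]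
        nlinarith

end Summit.AnomalousDissipation.AnomalousDissipation.Theorems.FloorCertificate.Negative
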